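/- Extra width seat `ym-line-cbag-p1-w4` (prover-ym-line-cbag-p1-w4-g0-0; own crux stmt-QuantumFields-22254 closed) of the cell of
ideator ym-idea-2: glue for LINE 7, route `GlueballBandRecursion` — part 2/2 of the RATE DICTIONARY for the finite-volume rate `q_N`. -/
import Summits.QuantumFields.YangMills.Theorems.GlueballBandRecursionPowerSum
import Summits.QuantumFields.YangMills.Theorems.DoublingDefectRecursionToGapSpectral
import Literature.MathematicalPhysics.QuantumFieldTheory.Balaban1983to89.InfiniteVolumeSufficientXII
import Literature.MathematicalPhysics.QuantumFieldTheory.YangMillsOS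

/-!
# Route `GlueballBandRecursion` (LINE 7 of ideator ym-idea-2): the RATE DICTIONARY — `q_N` is the top sub-dominant ratio

The three cruxes K1 `GapStableUnderRefinement` (stmt-QuantumFields-27508), K2 `ThermalMultiplicityUpper` (27507) and K3
`OneGlueballBandLower` (27506) of the route are all typed over the finite-volume rate

  `q_N(β) := ⨅ₖ x_{k+2}(N)^{1/(k+2)}`,  `x_t(N) = traceExcess r.ρ β N t = Z_β(N³ × t)/λ₀^t − 1`,

advertised as «the top excited ratio `λ₁/λ₀` of the `N³` transfer matrix».  This file proves that reading, and the
bookkeeping every proof of K1–K3 passes through, from the tree's trace formula `x_{m+2}(N) = Σ_{i ≠ i₀} (λᵢ/λ₀)^{m+2}`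
(`DoublingDefect.exists_ratios_hasSum_traceExcess`, over `exists_spectralData_wilsonTorusTransferMatrix`).  No physics is
claimed: §1 is pure real analysis, §§2–3 are its specialisations.

* §1 (part 1/2, `GlueballBandRecursionPowerSum.lean`) `PowerSum.*` — for a non-negative family `c` with power sums `X m = Σᵢ cᵢ^{m+2}` (all `m`): `cᵢ ≤ (X m)^{1/(m+2)}`,
  `X (m+1) ≤ (⨆ c)·X m`, the roots `m ↦ (X m)^{1/(m+2)}` are antitone and converge to their infimum, and the
  IDENTIFICATION `⨅ₘ (X m)^{1/(m+2)} = ⨆ᵢ cᵢ` (`ℓᵖ → ℓ^∞`; hard half by `X j ≤ (⨆ c)^j X 0`, roots, `j → ∞`); exact-rate decay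
  `X (m+j) ≤ (⨅ roots)^j · X m` and `(⨅ roots)^{m+2} ≤ X m`.
* §2 (rate of the route) — `root_traceExcess_antitone`, `tendsto_root_traceExcess` (`x_{k+2}^{1/(k+2)} ↓ q_N`),
  `traceExcess_add_le_rate_pow_mul` (`x_{k+j+2} ≤ q_N^j·x_{k+2}`; `traceExcess_two_mul_le_rate_pow_mul`: `x_{2t} ≤ q_N^t x_t`),
  `rate_pow_le_traceExcess` (`q_N^{m+2} ≤ x_{m+2}`), `rate_le_one` (EVERY `N`, every `β ≥ 0`), and the identification in two
  usable one-sided forms for ANY spectral bookkeeping of the trace excess (`ratio_le_rate`: each sub-dominant ratio `≤ q_N`;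
  `rate_le_of_forall_ratio_le`: `q_N ≤ B` once all sub-dominant ratios are `≤ B`; `rate_eq_iSup_ratio`), packaged over the
  tree's eigen-data of `wilsonTorusTransferMatrix` as `exists_eigenData_rate` (`λᵢ ≤ q_N·λ₀` for `i ≠ i₀`, and `q_N` is the least
  such factor).
* §3 — `rate_le_exp_neg_half_of_strongCoupling`: `q_N ≤ e^{-1/2}` for EVERY `N` on `0 ≤ β ≤ strongCouplingRadius ρ` (the rate
  reads off the exponential rate `e^{-⌊t/2⌋}` of the tree's tube estimate `traceExcess_le_of_strongCoupling`, the prefactor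
  `(48N³i)^{1/(2i)}` evaporating as `i → ∞`), hence `subdominant_le_exp_neg_half_of_strongCoupling`: every sub-dominant
  eigenvalue is `≤ e^{-1/2}λ₀`, volume-uniformly — the tree's `transferGap_of_strongCoupling` (`e^{-1/4}`) sharpened.

Route-independent (no `Theses` import: only the tree's transfer-matrix toolkit, the strong-coupling module XII and part 1/2),
so that route edits on `GlueballBandRecursion` do not rebuild it; the Assembly file's `traceExcess_nonneg` / `rate_nonneg` /
`rate_le_rpow` are the `PowerSum.nonneg` / `iInf_root_nonneg` / `iInf_root_le` instances below and are not restated.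

HONEST FRAMING.  Glue for an at-risk DRAFT line whose target is the strong-coupling RECORD-type rung
`Cruxes.IR.ColdPurityBridge.ColdDoublingRecursionStrongCoupling`; K1–K3 stay OPEN and nothing here bears on them beyond
bookkeeping.  No weak-coupling statement, no continuum statement, and certainly NOT the Yang–Mills mass gap (Clay), is
proved by anything in this file.
-/

set_option autoImplicit false

noncomputable section

open Filter Topology
open Literature.MathematicalPhysics.QuantumFieldTheory

namespace Summit.QuantumFields.YangMills.Theorems.GlueballBandRecursion

/-! ## §2 The route's rate `q_N = ⨅ₖ x_{k+2}(N)^{1/(k+2)}`: spectral identification and exact-rate decay -/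

section Rate

open Summit.QuantumFields.YangMills.Theorems.DoublingDefect (exists_ratios_hasSum_traceExcess)

variable {G : Type} [Group G] [TopologicalSpace G] [IsTopologicalGroup G] [CompactSpace G]
  [MeasurableSpace G] [BorelSpace G]

/-- **Re-indexing**: zeroing the top index turns the tree's `update`-shaped trace formula
`x_{m+2}(N) = Σ_{i ≠ i₀} qᵢ^{m+2}` into a plain power sum of the non-negative family `update q i₀ 0`. -/
theorem powerSum_of_update {β : ℝ} {N : ℕ} [NeZero N] {n : ℕ} {ρ : G →* Matrix (Fin n) (Fin n) ℂ}
    {ι : Type*} [DecidableEq ι] {q : ι → ℝ} {i₀ : ι} (hq : ∀ i, 0 ≤ q i)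
    (hx : ∀ m : ℕ, HasSum (Function.update (fun i => q i ^ (m + 2)) i₀ 0) (traceExcess ρ β N (m + 2))) :
    (∀ j, 0 ≤ Function.update q i₀ 0 j) ∧
      ∀ m : ℕ, HasSum (fun j => Function.update q i₀ 0 j ^ (m + 2)) (traceExcess ρ β N (m + 2)) := by
  refine ⟨fun j => ?_, fun m => ?_⟩
  · by_cases hj : j = i₀
    · subst hj
      simp
    · rw [Function.update_of_ne hj]
      exact hq j
  · have e : (fun j => Function.update q i₀ 0 j ^ (m + 2)) = Function.update (fun j => q j ^ (m + 2)) i₀ 0 := by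
      funext j
      by_cases hj : j = i₀
      · subst hj
        simp
      · simp [Function.update_of_ne hj]
    rw [e]
    exact hx m

/-- **The trace excess is a power sum**: for `β ≥ 0` there is a non-negative family `c ≤ 1` (the sub-dominant
ratios `λᵢ/λ₀`, `i ≠ i₀`, of the `N³` transfer matrix, the top index zeroed) with `x_{m+2}(N) = Σᵢ cᵢ^{m+2}` for every `m`
— the tree's `exists_ratios_hasSum_traceExcess`, re-indexed. -/
theorem exists_powerSum_traceExcess (r : LatticeRep G) {β : ℝ} (hβ : 0 ≤ β) (N : ℕ) [NeZero N] :
    ∃ (κ : Type) (c : κ → ℝ), (∀ i, 0 ≤ c i ∧ c i ≤ 1) ∧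
      ∀ m : ℕ, HasSum (fun i => c i ^ (m + 2)) (traceExcess r.ρ β N (m + 2)) := by
  haveI : SecondCountableTopology G :=
    (r.continuous.isClosedEmbedding r.injective).isEmbedding.secondCountableTopology
  obtain ⟨ι, _, q, i₀, hq, -, -, -, hx⟩ := exists_ratios_hasSum_traceExcess r.continuous r.mem_unitary hβ N
  obtain ⟨hc, hX⟩ := powerSum_of_update (fun i => (hq i).1) hx
  refine ⟨ι, Function.update q i₀ 0, fun i => ⟨hc i, ?_⟩, hX⟩
  by_cases hi : i = i₀
  · subst hi
    simp
  · rw [Function.update_of_ne hi]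
    exact (hq i).2

/-- **Monotonicity of the roots**: `k ↦ x_{k+2}(N)^{1/(k+2)}` is antitone (`β ≥ 0`) — `ℓᵖ`-norm monotonicity of the
sub-dominant ratios. -/
theorem root_traceExcess_antitone (r : LatticeRep G) {β : ℝ} (hβ : 0 ≤ β) (N : ℕ) [NeZero N] :
    Antitone (fun k : ℕ => traceExcess r.ρ β N (k + 2) ^ ((1 : ℝ) / ((k : ℝ) + 2))) := by
  obtain ⟨κ, c, hc, hX⟩ := exists_powerSum_traceExcess r hβ N
  exact PowerSum.root_antitone (X := fun m => traceExcess r.ρ β N (m + 2)) (fun i => (hc i).1) hX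

/-- **The rate is the limit of the roots**: `x_{k+2}(N)^{1/(k+2)} → q_N` as `k → ∞` (`β ≥ 0`). -/
theorem tendsto_root_traceExcess (r : LatticeRep G) {β : ℝ} (hβ : 0 ≤ β) (N : ℕ) [NeZero N] :
    Tendsto (fun k : ℕ => traceExcess r.ρ β N (k + 2) ^ ((1 : ℝ) / ((k : ℝ) + 2))) atTop
      (𝓝 (⨅ k : ℕ, traceExcess r.ρ β N (k + 2) ^ ((1 : ℝ) / ((k : ℝ) + 2)))) := by
  obtain ⟨κ, c, hc, hX⟩ := exists_powerSum_traceExcess r hβ N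
  exact PowerSum.tendsto_root (X := fun m => traceExcess r.ρ β N (m + 2)) (fun i => (hc i).1) hX

/-- **Exact-rate decay of the trace excess**: `x_{k+j+2}(N) ≤ q_N^j · x_{k+2}(N)` (`β ≥ 0`) — every further unit of
Euclidean time costs exactly one power of the rate `q_N` (the top sub-dominant ratio). -/
theorem traceExcess_add_le_rate_pow_mul (r : LatticeRep G) {β : ℝ} (hβ : 0 ≤ β) (N : ℕ) [NeZero N] (k j : ℕ) :
    traceExcess r.ρ β N (k + j + 2) ≤
      (⨅ k : ℕ, traceExcess r.ρ β N (k + 2) ^ ((1 : ℝ) / ((k : ℝ) + 2))) ^ j * traceExcess r.ρ β N (k + 2) := by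
  obtain ⟨κ, c, hc, hX⟩ := exists_powerSum_traceExcess r hβ N
  exact PowerSum.add_le_iInf_root_pow_mul (X := fun m => traceExcess r.ρ β N (m + 2)) (fun i => (hc i).1) hX k j

/-- **Doubling the Euclidean time**: `x_{2(m+2)}(N) ≤ q_N^{m+2} · x_{m+2}(N)` (`β ≥ 0`). -/
theorem traceExcess_two_mul_le_rate_pow_mul (r : LatticeRep G) {β : ℝ} (hβ : 0 ≤ β) (N : ℕ) [NeZero N] (m : ℕ) :
    traceExcess r.ρ β N (2 * (m + 2)) ≤
      (⨅ k : ℕ, traceExcess r.ρ β N (k + 2) ^ ((1 : ℝ) / ((k : ℝ) + 2))) ^ (m + 2) *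
        traceExcess r.ρ β N (m + 2) := by
  have h := traceExcess_add_le_rate_pow_mul r hβ N m (m + 2)
  convert h using 2
  ring

/-- **The rate's powers sit under the trace excess**: `q_N^{m+2} ≤ x_{m+2}(N)` (`β ≥ 0`). -/
theorem rate_pow_le_traceExcess (r : LatticeRep G) {β : ℝ} (hβ : 0 ≤ β) (N : ℕ) [NeZero N] (m : ℕ) :
    (⨅ k : ℕ, traceExcess r.ρ β N (k + 2) ^ ((1 : ℝ) / ((k : ℝ) + 2))) ^ (m + 2) ≤
      traceExcess r.ρ β N (m + 2) := by
  obtain ⟨κ, c, hc, hX⟩ := exists_powerSum_traceExcess r hβ N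
  exact PowerSum.iInf_root_pow_le (X := fun m => traceExcess r.ρ β N (m + 2)) (fun i => (hc i).1) hX m

/-- **The rate never exceeds one**: `q_N ≤ 1` for EVERY spatial period `N` and every `β ≥ 0` (it is a supremum of
ratios `λᵢ/λ₀ ≤ 1`; no strong-coupling smallness is needed). -/
theorem rate_le_one (r : LatticeRep G) {β : ℝ} (hβ : 0 ≤ β) (N : ℕ) [NeZero N] :
    (⨅ k : ℕ, traceExcess r.ρ β N (k + 2) ^ ((1 : ℝ) / ((k : ℝ) + 2))) ≤ 1 := by
  obtain ⟨κ, c, hc, hX⟩ := exists_powerSum_traceExcess r hβ N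
  exact PowerSum.iInf_root_le_of_forall_le (X := fun m => traceExcess r.ρ β N (m + 2)) (fun i => (hc i).1) hX
    zero_le_one fun i => (hc i).2

/-- **Every sub-dominant ratio is at most the rate** (hypothesis form, for ANY spectral bookkeeping of the trace
excess in the shape of `exists_ratios_hasSum_traceExcess`: ratios `qᵢ ≥ 0`, top index `i₀`,
`x_{m+2}(N) = Σ_{i ≠ i₀} qᵢ^{m+2}`): `qᵢ ≤ q_N` for `i ≠ i₀`. -/
theorem ratio_le_rate {β : ℝ} {N : ℕ} [NeZero N] {n : ℕ} {ρ : G →* Matrix (Fin n) (Fin n) ℂ}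
    {ι : Type*} [DecidableEq ι] {q : ι → ℝ} {i₀ : ι} (hq : ∀ i, 0 ≤ q i)
    (hx : ∀ m : ℕ, HasSum (Function.update (fun i => q i ^ (m + 2)) i₀ 0) (traceExcess ρ β N (m + 2)))
    {i : ι} (hi : i ≠ i₀) :
    q i ≤ ⨅ k : ℕ, traceExcess ρ β N (k + 2) ^ ((1 : ℝ) / ((k : ℝ) + 2)) := by
  obtain ⟨hc, hX⟩ := powerSum_of_update hq hx
  have h := PowerSum.le_iInf_root (X := fun m => traceExcess ρ β N (m + 2)) hc hX i
  rwa [Function.update_of_ne hi] at h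

/-- **The rate is the least such bound** (hypothesis form): if every sub-dominant ratio is `≤ B` (`B ≥ 0`) then
`q_N ≤ B`.  Together with `ratio_le_rate`: `q_N = sup_{i ≠ i₀} qᵢ = λ₁/λ₀`, the top sub-dominant ratio of the `N³`
transfer matrix. -/
theorem rate_le_of_forall_ratio_le {β : ℝ} {N : ℕ} [NeZero N] {n : ℕ} {ρ : G →* Matrix (Fin n) (Fin n) ℂ}
    {ι : Type*} [DecidableEq ι] {q : ι → ℝ} {i₀ : ι} (hq : ∀ i, 0 ≤ q i)
    (hx : ∀ m : ℕ, HasSum (Function.update (fun i => q i ^ (m + 2)) i₀ 0) (traceExcess ρ β N (m + 2)))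
    {B : ℝ} (hB : 0 ≤ B) (h : ∀ i, i ≠ i₀ → q i ≤ B) :
    (⨅ k : ℕ, traceExcess ρ β N (k + 2) ^ ((1 : ℝ) / ((k : ℝ) + 2))) ≤ B := by
  obtain ⟨hc, hX⟩ := powerSum_of_update hq hx
  refine PowerSum.iInf_root_le_of_forall_le (X := fun m => traceExcess ρ β N (m + 2)) hc hX hB fun j => ?_
  by_cases hj : j = i₀
  · subst hj
    simpa using hB
  · rw [Function.update_of_ne hj]
    exact h j hj

/-- **The rate as a supremum** (hypothesis form): `q_N = ⨆ᵢ (update q i₀ 0)ᵢ`, the supremum of the sub-dominant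
ratios (the top index zeroed). -/
theorem rate_eq_iSup_ratio {β : ℝ} {N : ℕ} [NeZero N] {n : ℕ} {ρ : G →* Matrix (Fin n) (Fin n) ℂ}
    {ι : Type*} [DecidableEq ι] {q : ι → ℝ} {i₀ : ι} (hq : ∀ i, 0 ≤ q i)
    (hx : ∀ m : ℕ, HasSum (Function.update (fun i => q i ^ (m + 2)) i₀ 0) (traceExcess ρ β N (m + 2))) :
    (⨅ k : ℕ, traceExcess ρ β N (k + 2) ^ ((1 : ℝ) / ((k : ℝ) + 2))) = ⨆ i, Function.update q i₀ 0 i := by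
  obtain ⟨hc, hX⟩ := powerSum_of_update hq hx
  exact PowerSum.iInf_root_eq_iSup (X := fun m => traceExcess ρ β N (m + 2)) hc hX

open scoped Classical in
/-- **The rate in the tree's transfer-matrix eigen-data** (`β ≥ 0`): there is a countable orthonormal eigenbasis
`bᵢ` of `wilsonTorusTransferMatrix r.ρ β N` on `L²(G^{E₃})`, eigenvalues `0 ≤ λᵢ ≤ λ_{i₀} = transferSpectralRadius`,
`λ_{i₀} > 0`, carrying the trace formula `x_{m+2}(N) = Σ_{i ≠ i₀} (λᵢ/λ_{i₀})^{m+2}` (so every finite partial sum of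
sub-dominant ratio powers sits under the trace excess, `sum_le_hasSum`), such that `q_N·λ_{i₀}` bounds EVERY sub-dominant
eigenvalue `λᵢ`, `i ≠ i₀`, and is the LEAST such multiple of `λ_{i₀}`: `q_N = λ₁/λ₀`, the glueball mass of the `N³` torus
being `−log q_N`. -/
theorem exists_eigenData_rate (r : LatticeRep G) {β : ℝ} (hβ : 0 ≤ β) (N : ℕ) [NeZero N] :
    ∃ (s : Set (MeasureTheory.Lp ℝ 2 (MeasureTheory.Measure.pi fun _ : Edge 3 N => haarProbability G)))
      (_ : Countable s)
      (b : HilbertBasis s ℝ (MeasureTheory.Lp ℝ 2 (MeasureTheory.Measure.pi fun _ : Edge 3 N => haarProbability G)))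
      (lam : s → ℝ) (i₀ : s),
      (∀ i, wilsonTorusTransferMatrix r.ρ β N (b i) = lam i • b i) ∧
      (∀ i, 0 ≤ lam i ∧ lam i ≤ lam i₀) ∧ 0 < lam i₀ ∧ transferSpectralRadius r.ρ β N = lam i₀ ∧
      (∀ m : ℕ, HasSum (Function.update (fun i => (lam i / lam i₀) ^ (m + 2)) i₀ 0)
        (traceExcess r.ρ β N (m + 2))) ∧
      (∀ i, i ≠ i₀ →
        lam i ≤ (⨅ k : ℕ, traceExcess r.ρ β N (k + 2) ^ ((1 : ℝ) / ((k : ℝ) + 2))) * lam i₀) ∧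
      ∀ B : ℝ, 0 ≤ B → (∀ i, i ≠ i₀ → lam i ≤ B * lam i₀) →
        (⨅ k : ℕ, traceExcess r.ρ β N (k + 2) ^ ((1 : ℝ) / ((k : ℝ) + 2))) ≤ B := by
  classical
  haveI : SecondCountableTopology G :=
    (r.continuous.isClosedEmbedding r.injective).isEmbedding.secondCountableTopology
  obtain ⟨s, hs, b, lam, i₀, hb, hle, hL0, -, -, hrad, hZ⟩ :=
    exists_spectralData_wilsonTorusTransferMatrix N r.continuous r.mem_unitary hβ
  -- the ratios `qᵢ = λᵢ/λ_{i₀}` carry the trace excess off the top index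
  set q : s → ℝ := fun i => lam i / lam i₀ with hqdef
  have hq : ∀ i, 0 ≤ q i := fun i => div_nonneg (hle i).1 hL0.le
  have hx : ∀ m : ℕ, HasSum (Function.update (fun i => q i ^ (m + 2)) i₀ 0) (traceExcess r.ρ β N (m + 2)) := by
    intro m
    have h := (hZ m).div_const (lam i₀ ^ (m + 2))
    have h1 : HasSum (fun i => q i ^ (m + 2)) (cyclicPartition r.ρ β N (m + 2) / lam i₀ ^ (m + 2)) := by
      refine h.congr_fun fun i => ?_
      rw [hqdef, div_pow]
    have h2 := h1.update i₀ 0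
    have hq0 : q i₀ = 1 := div_self hL0.ne'
    rw [hq0, one_pow] at h2
    have hxe : traceExcess r.ρ β N (m + 2) = 0 - 1 + cyclicPartition r.ρ β N (m + 2) / lam i₀ ^ (m + 2) := by
      unfold traceExcess
      rw [hrad]
      ring
    rw [hxe]
    exact h2
  refine ⟨s, hs, b, lam, i₀, hb, hle, hL0, hrad, hx, fun i hi => ?_, fun B hB h => ?_⟩
  · have h := ratio_le_rate hq hx hi
    rw [hqdef] at h
    exact (div_le_iff₀ hL0).1 h
  · exact rate_le_of_forall_ratio_le hq hx hB fun i hi => (div_le_iff₀ hL0).2 (h i hi)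

end Rate

/-! ## §3 On the strong-coupling window the rate is at most `e^{-1/2}`, for EVERY spatial period -/

section StrongCoupling

open Literature.MathematicalPhysics.QuantumFieldTheory.Balaban1983to89.Missing (strongCouplingRadius
  traceExcess_le_of_strongCoupling)

variable {G : Type} [Group G] [TopologicalSpace G] [IsTopologicalGroup G] [CompactSpace G]
  [MeasurableSpace G] [BorelSpace G]

/-- **Rate bound on the strong-coupling window**: `q_N ≤ e^{-1/2}` for every `N` and all
`0 ≤ β ≤ strongCouplingRadius ρ` — from the tree's tube estimate `x_{2i}(N) ≤ exp(24N³·i·e^{−i}) − 1`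
(`traceExcess_le_of_strongCoupling` at even times) by taking `2i`-th roots and `i → ∞` (`(48N³i)^{1/(2i)} → 1`):
the rate sees the exponential RATE `e^{-⌊t/2⌋}` of the tube estimate exactly, while its polynomial prefactor
evaporates.  (The tree's `transferGap_of_strongCoupling` records the weaker `e^{-1/4}`.) -/
theorem rate_le_exp_neg_half_of_strongCoupling (r : LatticeRep G) {β : ℝ} (hβ0 : 0 ≤ β)
    (hβ : β ≤ strongCouplingRadius r.ρ) (N : ℕ) [NeZero N] :
    (⨅ k : ℕ, traceExcess r.ρ β N (k + 2) ^ ((1 : ℝ) / ((k : ℝ) + 2))) ≤ Real.exp (-(1 / 2)) := by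
  haveI : SecondCountableTopology G :=
    (r.continuous.isClosedEmbedding r.injective).isEmbedding.secondCountableTopology
  obtain ⟨κ, c, hc, hX⟩ := exists_powerSum_traceExcess r hβ0 N
  have hc0 : ∀ i, 0 ≤ c i := fun i => (hc i).1
  set Q : ℝ := ⨅ k : ℕ, traceExcess r.ρ β N (k + 2) ^ ((1 : ℝ) / ((k : ℝ) + 2)) with hQ
  -- the tube estimate at even times `2(j+1)`: `x_{2j+2} ≤ exp(u_j) - 1`, `u_j = 24 N³ (j+1) e^{-(j+1)}`
  set D : ℝ := 24 * (N : ℝ) ^ 3 with hD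
  have hDpos : 0 < D := by
    have hN : (0 : ℝ) < N := by exact_mod_cast Nat.pos_of_ne_zero (NeZero.ne N)
    positivity
  set u : ℕ → ℝ := fun j => D * (((j : ℝ) + 1) * Real.exp (-((j : ℝ) + 1))) with hu
  have hu0 : ∀ j, 0 ≤ u j := fun j => by positivity
  have hmaj : ∀ j : ℕ, traceExcess r.ρ β N (2 * j + 2) ≤ Real.exp (u j) - 1 := by
    intro j
    have h := traceExcess_le_of_strongCoupling r.ρ r.continuous r.mem_unitary hβ0 hβ N (2 * j)
    have hk : (2 * j + 2) / 2 = j + 1 := by omega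
    rw [hk] at h
    have hcast : 12 * (N : ℝ) ^ 3 * (((2 * j : ℕ) : ℝ) + 2) * Real.exp (-(((j + 1 : ℕ) : ℝ))) = u j := by
      rw [hu, hD]
      push_cast
      ring
    rw [hcast] at h
    exact h
  -- `u_j → 0`, so eventually `u_j ≤ 1` and then `x_{2j+2} ≤ 2 u_j`
  have hu_tendsto : Tendsto u atTop (𝓝 0) := by
    have h1 : Tendsto (fun x : ℝ => x ^ 1 * Real.exp (-x)) atTop (𝓝 0) :=
      Real.tendsto_pow_mul_exp_neg_atTop_nhds_zero 1
    have h2 : Tendsto (fun j : ℕ => (j : ℝ) + 1) atTop atTop :=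
      tendsto_natCast_atTop_atTop.atTop_add tendsto_const_nhds
    have h3 := (h1.comp h2).const_mul D
    rw [mul_zero] at h3
    refine h3.congr fun j => ?_
    simp only [Function.comp_apply, pow_one, hu]
  have hev : ∀ᶠ j : ℕ in atTop, u j ≤ 1 :=
    ((tendsto_order.1 hu_tendsto).2 1 one_pos).mono fun j hj => hj.le
  -- the root bound: for `u_j ≤ 1`, `Q ≤ (2u_j)^{1/(2j+2)} = (2D(j+1))^{1/(2(j+1))} · e^{-1/2}`
  set A : ℕ → ℝ := fun j => (2 * D * ((j : ℝ) + 1)) ^ ((1 : ℝ) / (2 * ((j : ℝ) + 1))) with hA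
  have hbound : ∀ᶠ j : ℕ in atTop, Q ≤ A j * Real.exp (-(1 / 2)) := by
    refine hev.mono fun j hj => ?_
    have hx0 : 0 ≤ traceExcess r.ρ β N (2 * j + 2) :=
      PowerSum.nonneg (X := fun m => traceExcess r.ρ β N (m + 2)) hc0 hX (2 * j)
    have hx2 : traceExcess r.ρ β N (2 * j + 2) ≤ 2 * u j := by
      have h1 := hmaj j
      have h2 : Real.exp (u j) - 1 ≤ 2 * u j := by
        have habs : |u j| ≤ 1 := by rw [abs_of_nonneg (hu0 j)]; exact hj
        have h3 := Real.abs_exp_sub_one_le habs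
        rw [abs_of_nonneg (hu0 j)] at h3
        exact (le_abs_self _).trans h3
      linarith
    have he0 : 0 ≤ (1 : ℝ) / (((2 * j : ℕ) : ℝ) + 2) := by positivity
    have hroot : Q ≤ traceExcess r.ρ β N (2 * j + 2) ^ ((1 : ℝ) / (((2 * j : ℕ) : ℝ) + 2)) :=
      PowerSum.iInf_root_le (X := fun m => traceExcess r.ρ β N (m + 2)) hc0 hX (2 * j)
    have hstep : traceExcess r.ρ β N (2 * j + 2) ^ ((1 : ℝ) / (((2 * j : ℕ) : ℝ) + 2)) ≤
        (2 * u j) ^ ((1 : ℝ) / (((2 * j : ℕ) : ℝ) + 2)) :=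
      Real.rpow_le_rpow hx0 hx2 he0
    have hsplit : (2 * u j) ^ ((1 : ℝ) / (((2 * j : ℕ) : ℝ) + 2)) = A j * Real.exp (-(1 / 2)) := by
      have he : (1 : ℝ) / (((2 * j : ℕ) : ℝ) + 2) = 1 / (2 * ((j : ℝ) + 1)) := by
        push_cast
        ring
      have h2u : 2 * u j = (2 * D * ((j : ℝ) + 1)) * Real.exp (-((j : ℝ) + 1)) := by
        rw [hu]
        ring
      rw [he, h2u, Real.mul_rpow (by positivity) (Real.exp_pos _).le, hA, ← Real.exp_mul]
      congr 2
      field_simp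
    calc Q ≤ traceExcess r.ρ β N (2 * j + 2) ^ ((1 : ℝ) / (((2 * j : ℕ) : ℝ) + 2)) := hroot
      _ ≤ (2 * u j) ^ ((1 : ℝ) / (((2 * j : ℕ) : ℝ) + 2)) := hstep
      _ = A j * Real.exp (-(1 / 2)) := hsplit
  -- `A_j = (2D)^{e_j} · ((j+1)^{1/(j+1)})^{1/2} → 1`, `e_j = 1/(2(j+1)) → 0`
  have he_tendsto : Tendsto (fun j : ℕ => (1 : ℝ) / (2 * ((j : ℝ) + 1))) atTop (𝓝 0) := by
    have h := (tendsto_one_div_add_atTop_nhds_zero_nat (𝕜 := ℝ)).const_mul (1 / 2)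
    rw [mul_zero] at h
    refine h.congr fun j => ?_
    field_simp
  have hA1 : Tendsto (fun j : ℕ => (2 * D) ^ ((1 : ℝ) / (2 * ((j : ℝ) + 1)))) atTop (𝓝 1) := by
    have h := tendsto_const_nhds.rpow he_tendsto (Or.inl (by positivity : (2 * D) ≠ 0))
    rwa [Real.rpow_zero] at h
  have hA2 : Tendsto (fun j : ℕ => ((j : ℝ) + 1) ^ ((1 : ℝ) / (2 * ((j : ℝ) + 1)))) atTop (𝓝 1) := by
    have h1 : Tendsto (fun j : ℕ => ((j : ℝ) + 1) ^ ((1 : ℝ) / ((j : ℝ) + 1))) atTop (𝓝 1) :=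
      tendsto_rpow_div.comp (tendsto_natCast_atTop_atTop.atTop_add tendsto_const_nhds)
    have h2 := h1.rpow_const (p := (1 : ℝ) / 2) (Or.inl one_ne_zero)
    rw [Real.one_rpow] at h2
    refine h2.congr fun j => ?_
    have hj0 : (0 : ℝ) ≤ (j : ℝ) + 1 := by positivity
    rw [← Real.rpow_mul hj0]
    congr 1
    field_simp
  have hA_tendsto : Tendsto A atTop (𝓝 1) := by
    have h := hA1.mul hA2
    rw [mul_one] at h
    refine h.congr fun j => ?_
    simp only [hA]
    have hj0 : (0 : ℝ) ≤ (j : ℝ) + 1 := by positivity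
    exact (Real.mul_rpow (x := 2 * D) (y := (j : ℝ) + 1) (z := (1 : ℝ) / (2 * ((j : ℝ) + 1)))
      (by positivity) hj0).symm
  have hlim : Tendsto (fun j : ℕ => A j * Real.exp (-(1 / 2))) atTop (𝓝 (1 * Real.exp (-(1 / 2)))) :=
    hA_tendsto.mul tendsto_const_nhds
  rw [one_mul] at hlim
  exact ge_of_tendsto hlim hbound

/-- **A volume-uniform transfer-matrix gap of `1/2` lattice unit on the strong-coupling window** — the tree's
`transferGap_of_strongCoupling` (rate `e^{-1/4}`) sharpened through the rate dictionary: for every spatial period `N`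
and all `0 ≤ β ≤ strongCouplingRadius ρ`, in an orthonormal eigenbasis of `wilsonTorusTransferMatrix r.ρ β N`, every
sub-dominant eigenvalue is `≤ e^{-1/2}·λ₀`.  (Strong coupling, group-blind; no weak-coupling content.) -/
theorem subdominant_le_exp_neg_half_of_strongCoupling (r : LatticeRep G) {β : ℝ} (hβ0 : 0 ≤ β)
    (hβ : β ≤ strongCouplingRadius r.ρ) (N : ℕ) [NeZero N] :
    ∃ (s : Set (MeasureTheory.Lp ℝ 2 (MeasureTheory.Measure.pi fun _ : Edge 3 N => haarProbability G)))
      (_ : Countable s)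
      (b : HilbertBasis s ℝ (MeasureTheory.Lp ℝ 2 (MeasureTheory.Measure.pi fun _ : Edge 3 N => haarProbability G)))
      (lam : s → ℝ) (i₀ : s),
      (∀ i, wilsonTorusTransferMatrix r.ρ β N (b i) = lam i • b i) ∧
      (∀ i, 0 ≤ lam i ∧ lam i ≤ lam i₀) ∧ 0 < lam i₀ ∧ transferSpectralRadius r.ρ β N = lam i₀ ∧
      ∀ i, i ≠ i₀ → lam i ≤ Real.exp (-(1 / 2)) * lam i₀ := by
  obtain ⟨s, hs, b, lam, i₀, hb, hle, hL0, hrad, -, hsub, -⟩ := exists_eigenData_rate r hβ0 N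
  have hQ := rate_le_exp_neg_half_of_strongCoupling r hβ0 hβ N
  exact ⟨s, hs, b, lam, i₀, hb, hle, hL0, hrad, fun i hi =>
    (hsub i hi).trans (mul_le_mul_of_nonneg_right hQ hL0.le)⟩

end StrongCoupling

end Summit.QuantumFields.YangMills.Theorems.GlueballBandRecursion

end
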